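import Mathlib.Analysis.Calculus.Gradient.Basic
import Mathlib.Analysis.SpecialFunctions.ExpDeriv
import Literature.Analysis.PDE.LoewnerNirenbergKelvin
import Literature.Analysis.FluidPDE.RapidDecayLemmas
import Summits.NavierStokesRegularity.NavierStokesRegularity.Theorems.SelfMixingDichotomyMixingPayoffAdvectionDiffusionAniso
import HarnessLib

/-!
# Crux `MixingPayoff` (stmt-NavierStokesRegularity-1422), line `birth`, stub W2
  (`stub_advectionDiffusionSchwartz`): conjugation identities and time-continuity of slice
  derivatives

Helper file (lands `--supports stmt-NavierStokesRegularity-1422`). Pointwise identities for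
the conjugation `θ = e^{-w} g` by an exponential weight,

* `gradient_exp_neg_mul`: `∇(e^{-w} g) = e^{-w}(∇g − g ∇w)`,
* `laplacian_exp_neg`: `Δ(e^{-w}) = e^{-w}(‖∇w‖² − Δw)`,
* `laplacian_exp_neg_mul`: `Δ(e^{-w} g) = e^{-w}(Δg − 2⟪∇w, ∇g⟫ + g(‖∇w‖² − Δw))`

(Leibniz rule for the Laplacian, `Literature.Analysis.PDE.LoewnerNirenberg.laplacian_smul_apply`),
and the continuity in time, at a fixed space point, of the one-sided time derivative, the
gradient and the Laplacian of the slices of a jointly smooth field on a closed time slab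
(`IsSmoothSpaceTimeOn`): these let the pointwise equation pass to the initial time by
continuity.
-/

noncomputable section

open Set Function Filter Topology
open scoped ContDiff Topology InnerProductSpace Laplacian

-- `Summit = Problem` for this summit; the tree lakefile sets `weak.linter.dupNamespace = false`.
set_option linter.dupNamespace false

namespace Summit.NavierStokesRegularity.NavierStokesRegularity.Theorems.SelfMixingDichotomy.MixingPayoffBirth

open Literature.Analysis.FluidPDE Literature.Analysis.PDE.LoewnerNirenberg

-- nested operator types
set_option maxSynthPendingDepth 3

variable {E : Type} [NormedAddCommGroup E] [InnerProductSpace ℝ E] [FiniteDimensional ℝ E]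

/-! ### Conjugation identities -/

/-- `DF(x) v = ⟪∇F(x), v⟫`. -/
theorem fderiv_apply_eq_inner_gradient (F : E → ℝ) (x v : E) : fderiv ℝ F x v = ⟪gradient F x, v⟫_ℝ := by
  rw [gradient, InnerProductSpace.toDual_symm_apply]

omit [FiniteDimensional ℝ E] in
/-- The derivative of `e^{-w}`. -/
theorem hasFDerivAt_exp_neg {w : E → ℝ} {x : E} (hw : DifferentiableAt ℝ w x) :
    HasFDerivAt (fun y => Real.exp (-w y)) (Real.exp (-w x) • (-fderiv ℝ w x)) x :=
  hw.hasFDerivAt.fun_neg.exp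

/-- **Gradient of the conjugate**: `∇(e^{-w} g)(x) = e^{-w(x)} (∇g(x) − g(x) ∇w(x))`. -/
theorem gradient_exp_neg_mul {w g : E → ℝ} {x : E} (hw : DifferentiableAt ℝ w x)
    (hg : DifferentiableAt ℝ g x) :
    gradient (fun y => Real.exp (-w y) * g y) x =
      Real.exp (-w x) • (gradient g x - g x • gradient w x) := by
  have h : HasFDerivAt (fun y => Real.exp (-w y) * g y)
      (Real.exp (-w x) • fderiv ℝ g x + g x • (Real.exp (-w x) • (-fderiv ℝ w x))) x :=
    (hasFDerivAt_exp_neg hw).mul hg.hasFDerivAt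
  rw [gradient, h.fderiv, gradient, gradient]
  simp only [smul_neg, map_add, map_smul, map_neg, smul_sub]
  rw [smul_comm (g x) (Real.exp (-w x)) ((InnerProductSpace.toDual ℝ E).symm (fderiv ℝ w x))]
  abel

omit [FiniteDimensional ℝ E] in
/-- The derivative field of `e^{-w}` for a smooth `w`. -/
theorem fderiv_exp_neg_eq {w : E → ℝ} (hw : ContDiff ℝ ∞ w) :
    fderiv ℝ (fun y => Real.exp (-w y)) = fun y => (-Real.exp (-w y)) • fderiv ℝ w y := by
  funext y
  rw [(hasFDerivAt_exp_neg ((hw.differentiable (by simp)) y)).fderiv]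
  simp

/-- **Laplacian of the weight factor**: `Δ(e^{-w})(x) = e^{-w(x)} (‖∇w(x)‖² − Δw(x))`. -/
theorem laplacian_exp_neg {w : E → ℝ} (hw : ContDiff ℝ ∞ w) (x : E) :
    (Δ (fun y => Real.exp (-w y))) x = Real.exp (-w x) * (‖gradient w x‖ ^ 2 - (Δ w) x) := by
  classical
  set b := stdOrthonormalBasis ℝ E with hb
  have hwd : Differentiable ℝ w := hw.differentiable (by simp)
  have hwd2 : ∀ y, HasFDerivAt (fderiv ℝ w) (fderiv ℝ (fderiv ℝ w) y) y := fun y =>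
    ((hw.fderiv_right (m := ∞) (by simp)).differentiable (by simp) y).hasFDerivAt
  have hed : ∀ y, HasFDerivAt (fun y => -Real.exp (-w y)) (Real.exp (-w y) • fderiv ℝ w y) y := by
    intro y
    have h1 : HasFDerivAt (fun y => -Real.exp (-w y)) (-(Real.exp (-w y) • (-fderiv ℝ w y))) y :=
      (hasFDerivAt_exp_neg (hwd y)).fun_neg
    simpa using h1
  -- the second derivative of `e^{-w}`
  have hD2 : HasFDerivAt (fderiv ℝ fun y => Real.exp (-w y))
      ((-Real.exp (-w x)) • fderiv ℝ (fderiv ℝ w) x +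
        (Real.exp (-w x) • fderiv ℝ w x).smulRight (fderiv ℝ w x)) x := by
    rw [fderiv_exp_neg_eq hw]
    exact (hed x).smul (hwd2 x)
  rw [laplacian_eq_sum_fderiv_fderiv, hD2.fderiv, laplacian_eq_sum_fderiv_fderiv, mul_sub,
    Finset.mul_sum, ← b.sum_sq_inner_left (gradient w x), Finset.mul_sum, ← Finset.sum_sub_distrib]
  refine Finset.sum_congr rfl fun i _ => ?_
  simp only [add_apply, FunLike.coe_smul, Pi.smul_apply,
    ContinuousLinearMap.smulRight_apply, smul_eq_mul, fderiv_apply_eq_inner_gradient w x, ← hb]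
  ring

/-- **Laplacian of the conjugate**:
`Δ(e^{-w} g)(x) = e^{-w(x)} (Δg(x) − 2⟪∇w(x), ∇g(x)⟫ + g(x)(‖∇w(x)‖² − Δw(x)))`. -/
theorem laplacian_exp_neg_mul {w g : E → ℝ} (hw : ContDiff ℝ ∞ w) {x : E} (hg : ContDiffAt ℝ 2 g x) :
    (Δ (fun y => Real.exp (-w y) * g y)) x = Real.exp (-w x) *
      ((Δ g) x - 2 * ⟪gradient w x, gradient g x⟫_ℝ + g x * (‖gradient w x‖ ^ 2 - (Δ w) x)) := by
  classical
  set b := stdOrthonormalBasis ℝ E with hb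
  have hw2 : ContDiff ℝ 2 w := hw.of_le (WithTop.coe_le_coe.2 le_top)
  have he2 : ContDiffAt ℝ 2 (fun y => Real.exp (-w y)) x := (Real.contDiff_exp.comp hw2.neg).contDiffAt
  have h := laplacian_smul_apply (f := fun y => Real.exp (-w y)) (g := g) he2 hg b
  simp only [smul_eq_mul] at h
  rw [h, laplacian_exp_neg hw x]
  have hsum : ∑ i, fderiv ℝ (fun y => Real.exp (-w y)) x (b i) * fderiv ℝ g x (b i) =
      -Real.exp (-w x) * ⟪gradient w x, gradient g x⟫_ℝ := by
    rw [← b.sum_inner_mul_inner (gradient w x) (gradient g x), Finset.mul_sum]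
    refine Finset.sum_congr rfl fun i _ => ?_
    rw [(hasFDerivAt_exp_neg ((hw.differentiable (by simp)) x)).fderiv]
    simp only [FunLike.coe_smul, Pi.smul_apply, neg_apply, smul_eq_mul,
      fderiv_apply_eq_inner_gradient, real_inner_comm (b i)]
    ring
  rw [hsum]
  ring

/-! ### Continuity in time of slice derivatives of a jointly smooth field -/

section TimeContinuity

variable {S : Set ℝ} {u : ℝ → E → ℝ}

omit [FiniteDimensional ℝ E] in
/-- The joint derivative within the slab is continuous along each time line. -/
theorem continuousOn_fderivWithin_time (h : IsSmoothSpaceTimeOn S u) (hS : UniqueDiffOn ℝ S) (x : E) :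
    ContinuousOn (fun t => fderivWithin ℝ (uncurry u) (S ×ˢ univ) (t, x)) S := by
  have hc := (h.contDiffOn_fderivWithin hS).continuousOn
  exact hc.comp (continuous_id.prodMk continuous_const).continuousOn fun t ht => mk_mem_prod ht (mem_univ x)

omit [FiniteDimensional ℝ E] in
/-- **The one-sided time derivative is continuous in time** at a fixed point. -/
theorem continuousOn_timeDerivWithin_time (h : IsSmoothSpaceTimeOn S u) (hS : UniqueDiffOn ℝ S) (x : E) :
    ContinuousOn (fun t => timeDerivWithin S u t x) S := by
  have hc : ContinuousOn (fun t => fderivWithin ℝ (uncurry u) (S ×ˢ univ) (t, x) ((1 : ℝ), (0 : E))) S :=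
    (continuousOn_fderivWithin_time h hS x).clm_apply continuousOn_const
  exact hc.congr fun t ht => h.timeDerivWithin_eq hS ht x

/-- **The gradient of the slices is continuous in time** at a fixed point. -/
theorem continuousOn_gradient_time (h : IsSmoothSpaceTimeOn S u) (hS : UniqueDiffOn ℝ S) (x : E) :
    ContinuousOn (fun t => gradient (u t) x) S := by
  have hc : ContinuousOn (fun t => (InnerProductSpace.toDual ℝ E).symm
      ((fderivWithin ℝ (uncurry u) (S ×ˢ univ) (t, x)).comp (ContinuousLinearMap.inr ℝ ℝ E))) S :=
    (InnerProductSpace.toDual ℝ E).symm.continuous.comp_continuousOn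
      (((ContinuousLinearMap.compL ℝ E (ℝ × E) ℝ).flip (ContinuousLinearMap.inr ℝ ℝ E)).continuous.comp_continuousOn
        (continuousOn_fderivWithin_time h hS x))
  refine hc.congr fun t ht => ?_
  simp only [gradient, h.fderiv_slice_eq ht x]

set_option maxHeartbeats 800000 in
/-- **The Laplacian of the slices is continuous in time** at a fixed point. -/
theorem continuousOn_laplacian_time (h : IsSmoothSpaceTimeOn S u) (hS : UniqueDiffOn ℝ S) (x : E) :
    ContinuousOn (fun t => (Δ (u t)) x) S := by
  classical
  set b := stdOrthonormalBasis ℝ E with hb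
  have hSU : UniqueDiffOn ℝ (S ×ˢ (univ : Set E)) := hS.prod uniqueDiffOn_univ
  -- the second joint derivative along the time line
  have h2 : ContinuousOn (fun t => fderivWithin ℝ (fderivWithin ℝ (uncurry u) (S ×ˢ univ)) (S ×ˢ univ) (t, x)) S := by
    have hc := ((h.contDiffOn_fderivWithin hS).continuousOn_fderivWithin hSU (by simp))
    exact hc.comp (continuous_id.prodMk continuous_const).continuousOn fun t ht => mk_mem_prod ht (mem_univ x)
  have hterm : ∀ i, ContinuousOn (fun t => fderiv ℝ (fderiv ℝ (u t)) x (b i) (b i)) S := by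
    intro i
    have hc : ContinuousOn (fun t => (fderivWithin ℝ (fderivWithin ℝ (uncurry u) (S ×ˢ univ)) (S ×ˢ univ) (t, x)
        ((ContinuousLinearMap.inr ℝ ℝ E) (b i))) ((ContinuousLinearMap.inr ℝ ℝ E) (b i))) S :=
      (h2.clm_apply continuousOn_const).clm_apply continuousOn_const
    refine hc.congr fun t ht => ?_
    show fderiv ℝ (fderiv ℝ (u t)) x (b i) (b i) = _
    rw [(h.hasFDerivAt_fderiv_slice hS ht x).fderiv]
    rfl
  have hsum : ContinuousOn (fun t => ∑ i, fderiv ℝ (fderiv ℝ (u t)) x (b i) (b i)) S :=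
    continuousOn_finsetSum _ fun i _ => hterm i
  exact hsum.congr fun t _ => laplacian_eq_sum_fderiv_fderiv (u t) x

end TimeContinuity

/-- **Passing a pointwise identity to the initial time.** If `f`, `g` are continuous within
`[a, b]` at `a` (`a < b`) and agree on `(a, b]`, they agree at `a`. -/
theorem eq_at_left_of_eqOn_Ioc {f g : ℝ → ℝ} {a b : ℝ} (hab : a < b)
    (hf : ContinuousWithinAt f (Icc a b) a) (hg : ContinuousWithinAt g (Icc a b) a)
    (hfg : ∀ t ∈ Ioc a b, f t = g t) : f a = g a := by
  have hf' : Tendsto f (𝓝[Ioc a b] a) (𝓝 (f a)) := (hf.mono Ioc_subset_Icc_self).tendsto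
  have hg' : Tendsto g (𝓝[Ioc a b] a) (𝓝 (g a)) := (hg.mono Ioc_subset_Icc_self).tendsto
  have hev : f =ᶠ[𝓝[Ioc a b] a] g := eventually_nhdsWithin_of_forall hfg
  haveI : (𝓝[Ioc a b] a).NeBot := by
    rw [nhdsWithin_Ioc_eq_nhdsGT hab]; infer_instance
  exact tendsto_nhds_unique (hf'.congr' hev) hg'

/-- Anchor (registered sub-stub of stub W2): `laplacian_exp_neg` on `ℝ³` (closed form). -/
theorem w2aux_laplacianExpNeg : ∀ (w : EuclideanSpace ℝ (Fin 3) → ℝ), ContDiff ℝ ∞ w →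
    ∀ x : EuclideanSpace ℝ (Fin 3),
    (Δ (fun y => Real.exp (-w y))) x = Real.exp (-w x) * (‖gradient w x‖ ^ 2 - (Δ w) x) :=
  fun _ hw x => laplacian_exp_neg hw x

end Summit.NavierStokesRegularity.NavierStokesRegularity.Theorems.SelfMixingDichotomy.MixingPayoffBirth

end
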